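import Summits.HodgeConjecture.HodgeConjecture.Cruxes.BlochSeedDiscOne.PhaseTorusCoverFacts
import Summits.HodgeConjecture.HodgeConjecture.Cruxes.BlochSeedDiscOne.PhaseTorusCoverCert
import Summits.HodgeConjecture.HodgeConjecture.Cruxes.BlochSeedDiscOne.PhaseTorusLawN14

/-!
# BlochSeedDiscOne ▸ THE PHASE-TORUS LAW AT CORANK ≤ 13 — the exact threshold `γ* : 13 ∕ 14` (strengthen g20)

HONESTY LABEL. Nothing in this file is a theorem toward HC / HC_CM / HC_AV / №4 / 26512 / 18881 / H2; it proves no rung and closes no shell of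
`SPlus 14 sigmaH 0`. It is kernel-checked evidence for the strengthen lens (an S⁺ whose proof is a FINITE LETTER CALCULUS on the phase torus).

THEOREM (`phaseTorusLawN_thirteen`, kernel, STD axioms, no `native_decide`). `PhaseTorusLawN 13`: a real signed measure `ω` on the phase torus
`(ℤ/4)⁴` whose clean moments vanish (`KAdm k → ω̂(k) = 0`) and which is non-positive outside at most THIRTEEN points has `ω̂(1,1,1,1) = 0`.  With
`PhaseTorusLawN14.not_phaseTorusLawN_fourteen` this is SHARP: **`phaseTorusLawN_iff : PhaseTorusLawN γ ↔ γ ≤ 13`** — the corank window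
`10 ≤ γ* ≤ 13` left open by `PhaseTorusBoxLaw.phaseTorusLawN_ten` and `PhaseTorusLawN14` (both g18) is closed, and the torus input of every
phase-torus theorem of the tree (`LinePhaseTorus.lineTwoTermUp_mu_eq_zero_of_law`, `AxisPhaseTorus.hf_mu_eq_zero_of_law`,
`AxisPhaseTorus.mu_eq_zero_of_few_posClasses`) is exhausted at `γ = 13`.

PROOF. §7 Reduction (verbatim the frame of `phaseTorusLawN_ten`): by the BOX LAW (`PhaseTorusBoxLaw.boxLaw`) `32·Σ_{pbox s} ω = −Re(e(−j) μ)` on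
the corner class `Σ s = j`; if `μ ≠ 0` some class `j` has all its `64` box sums positive, so the positive set `A` meets every box of class `j`.  The
new input is the **COVERING THEOREM `cover13`: `t(𝓑_j) ≥ 14`** — no `13` points of `(ℤ/4)⁴` meet all `64` boxes `s + {0,1}⁴`, `Σ s = j` (and `14`
do: the support of `PhaseTorusLawN14.omega14`).  A translation makes `j = 0` (§1 `hitsAll_translate`).
§1–§3 (pen, typed). Index class-`0` boxes by SLICE `z = s₂` and `4s₀ + s₁`; a point of LEVEL `ℓ = τ₂` meets only the slices `ℓ−1, ℓ`, at most three
boxes each (`PhaseTorusCoverFacts.maskTab_local/three`).  Double counting per slice (`Cover.sixteen_le`): `16 ≤ 3(c_z + c_{z+1})` for the level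
counts `c` (`count_levels`); with `Σ c ≤ 13` two ADJACENT slices are tight, WLOG (translation by a vector of sum `0`) `c₁ + c₂ = 6 = c₂ + c₃`
(`normalise_one`).
§4 TIGHTNESS (`tight_one`, `tight_two` ← kernel certificates `certL1`, `certL2` + `Cover.srch_sound`): in a tight slice each of its six points meets
EXACTLY three of its boxes, which forces the residues `Σ τ mod 4`: level `1 ↦ {1,2}`, `2 ↦ {2}`, `3 ↦ {2,3}` (`allowed_of_tight`, `level_two_of_tight`).
§5 MAIN FRAME: with `a = c₁` the counts are `(≤ 7−a, a, 6−a, ≤ a)`; `a = 6`: `certMain_six` fails the search outright (`frame_six`); `a ≤ 5`: the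
level-`2` points other than `p₀ = (0,0,2,0)` form the PLACEMENT `place A ⊆ lv2rest` (a `(5−a)`-sublist of the `15` admissible codes), and a
certificate `certMainL ob a R` covering the placement refutes the transversal (`frame_main` ← `Cover.srch_sound`, table completeness
`tabMain_complete`).
§6 NORMALISATIONS: a level-`2` point is moved to `p₀` by a translation of sum `0` fixing levels (`normalise_two`); the group `S₃` of the coordinates
`0, 1, 3` (`permPT`; fixes levels, classes, `p₀`) carries the placement into the certified list of orbit representatives
(`PhaseTorusCoverCert.R`, coverage `cover_spec`) — `hitsAll_perm`, `cntN_perm`, `place_perm`; `cover13_zero`, then `cover13` for every class.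
§7 `phaseTorusLawN_thirteen`, `phaseTorus_threshold`, `phaseTorusLawN_iff`.
Kernel cost: `PhaseTorusCoverFacts` ≈ 170 s, `PhaseTorusCoverCert` ≈ 210 s (≈ 63 000 search nodes + coverage), this file seconds.

USE (typed in `AxisPhaseTorus21.lean`): the METHOD CEILING of the axis-room phase-torus law moves from `rank ≤ 18` (`γ = 10`) to its final value
`rank ≤ 21` (`γ = 13`); an inhabitant of the door of record in the (relaxed) axis room has `≥ 14` positive and `≥ 14` negative classes and
`rank ≥ 22`; `LinePhaseTorus.lineTwoTermUp_mu_eq_zero_of_law` holds unconditionally up to corank `13`.  By `phaseTorusLawN_iff` no larger `γ`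
can be fed to these theorems.
-/

set_option linter.dupNamespace false
set_option autoImplicit false

namespace Summit.HodgeConjecture.HodgeConjecture.Cruxes.BlochSeedDiscOne.PhaseTorus

open Finset BigOperators Cover

/-! ## §1 class membership, translations, level counts -/

theorem mem_cornerClass_iff {j : ZMod 4} {s : PT} : s ∈ cornerClass j ↔ ∑ f, s f = j := by
  constructor
  · exact sum_of_mem_cornerClass
  · intro h
    rw [cornerClass, Finset.mem_image]
    refine ⟨![s 0, s 1, s 2], Finset.mem_univ _, ?_⟩
    rw [Fin.sum_univ_four] at h
    funext f
    fin_cases f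
    · simp [cornerOf]
    · simp [cornerOf]
    · simp [cornerOf]
    · simp [cornerOf]
      rw [← h]
      ring

/-- `A` meets all `64` boxes of class `j`. -/
def HitsAll (A : Finset PT) (j : ZMod 4) : Prop := ∀ s ∈ cornerClass j, ∃ a ∈ A, a ∈ pbox s

theorem mem_pbox_add {s τ v : PT} : τ + v ∈ pbox (s + v) ↔ τ ∈ pbox s := by
  simp only [mem_pbox, Pi.add_apply]
  refine forall_congr' fun f => ?_
  constructor
  · rintro (h | h)
    · exact Or.inl (add_right_cancel h)
    · right
      rw [add_right_comm] at h
      exact add_right_cancel h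
  · rintro (h | h)
    · exact Or.inl (by rw [h])
    · right
      rw [h, add_right_comm]

/-- translating a transversal of class `j` by `v` gives a transversal of class `j + Σ v`. -/
theorem hitsAll_translate (A : Finset PT) (j : ZMod 4) (v : PT) (h : HitsAll A j) :
    HitsAll (A.image (· + v)) (j + ∑ f, v f) := by
  intro s hs
  have hs' : s - v ∈ cornerClass j := by
    rw [mem_cornerClass_iff] at hs ⊢
    simp only [Pi.sub_apply, Finset.sum_sub_distrib, hs]
    ring
  obtain ⟨a, ha, hab⟩ := h (s - v) hs'
  refine ⟨a + v, Finset.mem_image.2 ⟨a, ha, rfl⟩, ?_⟩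
  have e : s = (s - v) + v := by simp
  rw [e, mem_pbox_add]
  exact hab

theorem card_translate (A : Finset PT) (v : PT) : (A.image (· + v)).card = A.card :=
  Finset.card_image_of_injective _ (add_left_injective v)

/-- the number of points of `A` on LEVEL `w` (third coordinate `w`). -/
def cntN (A : Finset PT) (w : ℕ) : ℕ := (A.filter fun τ => (τ 2).val = w).card

theorem val_lt4 (x : ZMod 4) : x.val < 4 := ZMod.val_lt x

theorem cntN_translate (A : Finset PT) (v : PT) (w : ℕ) (hw : w < 4) :
    cntN (A.image (· + v)) ((w + (v 2).val) % 4) = cntN A w := by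
  classical
  unfold cntN
  have hset : (A.image (· + v)).filter (fun τ => (τ 2).val = (w + (v 2).val) % 4) =
      (A.filter fun τ => (τ 2).val = w).image (· + v) := by
    ext τ
    simp only [Finset.mem_filter, Finset.mem_image]
    constructor
    · rintro ⟨⟨a, ha, rfl⟩, h2⟩
      refine ⟨a, ⟨ha, ?_⟩, rfl⟩
      rw [Pi.add_apply, ZMod.val_add] at h2
      have := val_lt4 (a 2)
      have := val_lt4 (v 2)
      omega
    · rintro ⟨a, ⟨ha, h2⟩, rfl⟩
      refine ⟨⟨a, ha, rfl⟩, ?_⟩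
      rw [Pi.add_apply, ZMod.val_add, h2]
  rw [hset, Finset.card_image_of_injective _ (add_left_injective v)]

theorem card_eq_sum_cntN (A : Finset PT) : A.card = cntN A 0 + cntN A 1 + cntN A 2 + cntN A 3 := by
  classical
  have h := Finset.card_eq_sum_card_fiberwise (f := fun τ : PT => (τ 2).val) (s := A) (t := Finset.range 4)
    (fun τ _ => Finset.mem_coe.2 (Finset.mem_range.2 (val_lt4 _)))
  rw [h, Finset.sum_range_succ, Finset.sum_range_succ, Finset.sum_range_succ, Finset.sum_range_succ,
    Finset.sum_range_zero, zero_add]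
  rfl

/-! ## §2 codes: points and boxes against the table `maskTab` -/

/-- slice mask of a torus point. -/
def pm (τ : PT) (z : ℕ) : ℕ := maskTab (τ 0).val (τ 1).val (τ 2).val (τ 3).val z

/-- admissibility of a torus point for the main search. -/
def allowedP (τ : PT) : Prop := allowedN (τ 0).val (τ 1).val (τ 2).val (τ 3).val

theorem mkPT_val (τ : PT) : mkPT (τ 0).val (τ 1).val (τ 2).val (τ 3).val = τ := by
  funext f
  fin_cases f <;> simp [mkPT]

theorem bxN_eq (s : PT) (hs : s ∈ cornerClass 0) : bxN (s 0).val (s 1).val (s 2).val = s := by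
  obtain ⟨t, _, rfl⟩ := Finset.mem_image.1 hs
  unfold bxN
  congr 1
  funext i
  fin_cases i <;> simp [cornerOf]

/-- every box `(z, i)` of class `0` is met by a transversal, in table form. -/
theorem exists_hit (A : Finset PT) (hA : HitsAll A 0) (z : ℕ) (hz : z < 4) (i : ℕ) (hi : i < 16) :
    ∃ a ∈ A, (pm a z).testBit i = true := by
  have hs : bxN (i / 4) (i % 4) z ∈ cornerClass 0 := Finset.mem_image.2 ⟨_, Finset.mem_univ _, rfl⟩
  obtain ⟨a, ha, hab⟩ := hA _ hs
  refine ⟨a, ha, ?_⟩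
  have key := (maskTab_spec (a 0).val (val_lt4 _) (a 1).val (val_lt4 _) (a 2).val (val_lt4 _) (a 3).val (val_lt4 _)
    (i / 4) (by omega) (i % 4) (Nat.mod_lt _ (by norm_num)) z hz).1 (by rw [mkPT_val]; exact mem_pbox.1 hab)
  have hi' : 4 * (i / 4) + i % 4 = i := Nat.div_add_mod i 4
  rw [hi'] at key
  exact key

theorem pm_local (a : PT) (z : ℕ) (hz : z < 4) (i : ℕ) (hi : i < 16) (h : (pm a z).testBit i = true) :
    (a 2).val = z ∨ (a 2).val = (z + 1) % 4 :=
  maskTab_local _ (val_lt4 _) _ (val_lt4 _) _ (val_lt4 _) _ (val_lt4 _) z hz i hi h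

theorem pm_three (a : PT) (z : ℕ) (hz : z < 4) : hits16 (pm a z) ≤ 3 :=
  maskTab_three _ (val_lt4 _) _ (val_lt4 _) _ (val_lt4 _) _ (val_lt4 _) z hz

/-! ## §3 counting: two adjacent tight slices, first normalisation -/

/-- **`16 ≤ 3 · (c_y + c_{y+1})`**: slice `y` (sixteen boxes) is met only by the levels `y, y+1`, three boxes a point. -/
theorem count_levels (A : Finset PT) (hA : HitsAll A 0) (y : ℕ) (hy : y < 4) :
    16 ≤ 3 * (cntN A y + cntN A ((y + 1) % 4)) :=
  sixteen_le (cls := fun τ : PT => (τ 2).val) (mask := pm) A y (fun o _ i hi hb => pm_local o y hy i hi hb)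
    (fun o _ => pm_three o y hy) (fun i hi => exists_hit A hA y hy i hi)

/-- **first normalisation**: after a translation, slices `1` and `2` are TIGHT (`c₁ + c₂ = 6 = c₂ + c₃`). -/
theorem normalise_one (A : Finset PT) (hA : HitsAll A 0) (hcard : A.card ≤ 13) :
    ∃ B : Finset PT, HitsAll B 0 ∧ B.card = A.card ∧ cntN B 1 + cntN B 2 = 6 ∧ cntN B 2 + cntN B 3 = 6 := by
  have h0 := count_levels A hA 0 (by norm_num)
  have h1 := count_levels A hA 1 (by norm_num)
  have h2 := count_levels A hA 2 (by norm_num)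
  have h3 := count_levels A hA 3 (by norm_num)
  have hs := card_eq_sum_cntN A
  norm_num at h0 h1 h2 h3
  have t0 := cntN_translate A ![0, 0, 1, 3]
  have t2 := cntN_translate A ![0, 0, 3, 1]
  have t3 := cntN_translate A ![0, 0, 2, 2]
  have e0 : ((![0, 0, 1, 3] : PT) 2).val = 1 := by decide +kernel
  have e2 : ((![0, 0, 3, 1] : PT) 2).val = 3 := by decide +kernel
  have e3 : ((![0, 0, 2, 2] : PT) 2).val = 2 := by decide +kernel
  rw [e0] at t0
  rw [e2] at t2
  rw [e3] at t3
  have s0 : (0 : ZMod 4) + ∑ f, (![0, 0, 1, 3] : PT) f = 0 := by decide +kernel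
  have s2 : (0 : ZMod 4) + ∑ f, (![0, 0, 3, 1] : PT) f = 0 := by decide +kernel
  have s3 : (0 : ZMod 4) + ∑ f, (![0, 0, 2, 2] : PT) f = 0 := by decide +kernel
  have H0 := hitsAll_translate A 0 ![0, 0, 1, 3] hA
  have H2 := hitsAll_translate A 0 ![0, 0, 3, 1] hA
  have H3 := hitsAll_translate A 0 ![0, 0, 2, 2] hA
  rw [s0] at H0
  rw [s2] at H2
  rw [s3] at H3
  rcases (by omega : (cntN A 0 + cntN A 1 = 6 ∧ cntN A 1 + cntN A 2 = 6) ∨ (cntN A 1 + cntN A 2 = 6 ∧ cntN A 2 + cntN A 3 = 6)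
      ∨ (cntN A 2 + cntN A 3 = 6 ∧ cntN A 3 + cntN A 0 = 6) ∨ (cntN A 3 + cntN A 0 = 6 ∧ cntN A 0 + cntN A 1 = 6))
    with h | h | h | h
  · have a0 := t0 0 (by norm_num)
    have a1 := t0 1 (by norm_num)
    have a2 := t0 2 (by norm_num)
    rw [show (0 + 1) % 4 = 1 from rfl] at a0
    rw [show (1 + 1) % 4 = 2 from rfl] at a1
    rw [show (2 + 1) % 4 = 3 from rfl] at a2
    exact ⟨A.image (· + ![0, 0, 1, 3]), H0, card_translate _ _, by omega, by omega⟩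
  · exact ⟨A, hA, rfl, h.1, h.2⟩
  · have a2 := t2 2 (by norm_num)
    have a3 := t2 3 (by norm_num)
    have a0 := t2 0 (by norm_num)
    rw [show (2 + 3) % 4 = 1 from rfl] at a2
    rw [show (3 + 3) % 4 = 2 from rfl] at a3
    rw [show (0 + 3) % 4 = 3 from rfl] at a0
    exact ⟨A.image (· + ![0, 0, 3, 1]), H2, card_translate _ _, by omega, by omega⟩
  · have a3 := t3 3 (by norm_num)
    have a0 := t3 0 (by norm_num)
    have a1 := t3 1 (by norm_num)
    rw [show (3 + 2) % 4 = 1 from rfl] at a3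
    rw [show (0 + 2) % 4 = 2 from rfl] at a0
    rw [show (1 + 2) % 4 = 3 from rfl] at a1
    exact ⟨A.image (· + ![0, 0, 2, 2]), H3, card_translate _ _, by omega, by omega⟩

/-! ## §4 tightness (kernel certificates `certL1`, `certL2`) and admissibility -/

theorem hits16_zero : hits16 0 = 0 := by decide

/-- **slice 1 is met exactly**: when `c₁ + c₂ ≤ 6`, every point of levels `1, 2` meets THREE boxes of slice `1`. -/
theorem tight_one (A : Finset PT) (hA : HitsAll A 0) (h12 : cntN A 1 + cntN A 2 ≤ 6) :
    ∀ τ ∈ A, ((τ 2).val = 1 ∨ (τ 2).val = 2) → hits16 (pm τ 1) = 3 := by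
  classical
  intro τ hτ hlv
  by_contra hne
  have hcert := certL1 (τ 0).val (val_lt4 _) (τ 1).val (val_lt4 _) (τ 2).val (val_lt4 _) (τ 3).val (val_lt4 _) hlv hne
  have hT : TabOK (fun _ : PT => (1 : ℕ)) (fun o z => if z = 1 then pm o 1 else 0)
      (fun o => (o 2).val = 1 ∨ (o 2).val = 2) tabL1 :=
    { complete := by
        intro o ho z hz i hi hb
        by_cases hz1 : z = 1
        · subst hz1
          simp only [if_true] at hb
          have hm := tabL1_complete (o 0).val (val_lt4 _) (o 1).val (val_lt4 _) (o 2).val (val_lt4 _) (o 3).val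
            (val_lt4 _) ho i hi hb
          simpa [ent, pm] using hm
        · simp [hz1] at hb
      local_ := by
        intro o ho z hz i hi hb
        by_cases hz1 : z = 1
        · exact Or.inl hz1.symm
        · simp [hz1] at hb
      three := by
        intro o ho z hz
        by_cases hz1 : z = 1
        · simp only [hz1, if_true]
          exact pm_three o 1 (by norm_num)
        · simp [hz1, hits16_zero]
      cls_lt := fun _ _ => by norm_num }
  refine srch_sound hT false 14 65535 (pm τ 1) 65535 65535 0 5 0 0 (by norm_num) hcert
    ((A.filter fun o => (o 2).val = 1 ∨ (o 2).val = 2).erase τ) ⟨?_, ?_, ?_⟩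
  · intro o ho
    exact (Finset.mem_filter.1 (Finset.mem_of_mem_erase ho)).2
  · intro w hw
    dsimp only
    have hmem : τ ∈ (A.filter fun o => (o 2).val = 1 ∨ (o 2).val = 2) := Finset.mem_filter.2 ⟨hτ, hlv⟩
    have hc := Finset.card_erase_of_mem hmem
    have hle := card_filter_or_le A (fun o : PT => (o 2).val = 1) (fun o : PT => (o 2).val = 2)
    have hc' : ((A.filter fun o => (o 2).val = 1 ∨ (o 2).val = 2).erase τ).card ≤ 5 := by
      rw [hc]; unfold cntN at h12; omega
    interval_cases w
    · simp [sel]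
    · simpa [sel] using hc'
    · simp [sel]
    · simp [sel]
  · intro z hz i hi hci
    dsimp only at hci
    interval_cases z
    · exact absurd (testBit_full16 i hi) (by simpa [sel] using hci)
    · simp only [sel] at hci
      obtain ⟨a, ha, hab⟩ := exists_hit A hA 1 (by norm_num) i hi
      have hlv' : (a 2).val = 1 ∨ (a 2).val = 2 := by simpa using pm_local a 1 (by norm_num) i hi hab
      have hne' : a ≠ τ := by
        rintro rfl
        rw [hci] at hab
        exact Bool.false_ne_true hab
      exact ⟨a, Finset.mem_erase.2 ⟨hne', Finset.mem_filter.2 ⟨ha, hlv'⟩⟩, by simpa using hab⟩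
    · exact absurd (testBit_full16 i hi) (by simpa [sel] using hci)
    · exact absurd (testBit_full16 i hi) (by simpa [sel] using hci)

/-- **slice 2 is met exactly**: when `c₂ + c₃ ≤ 6`, every point of levels `2, 3` meets THREE boxes of slice `2`. -/
theorem tight_two (A : Finset PT) (hA : HitsAll A 0) (h23 : cntN A 2 + cntN A 3 ≤ 6) :
    ∀ τ ∈ A, ((τ 2).val = 2 ∨ (τ 2).val = 3) → hits16 (pm τ 2) = 3 := by
  classical
  intro τ hτ hlv
  by_contra hne
  have hcert := certL2 (τ 0).val (val_lt4 _) (τ 1).val (val_lt4 _) (τ 2).val (val_lt4 _) (τ 3).val (val_lt4 _) hlv hne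
  have hT : TabOK (fun _ : PT => (2 : ℕ)) (fun o z => if z = 2 then pm o 2 else 0)
      (fun o => (o 2).val = 2 ∨ (o 2).val = 3) tabL2 :=
    { complete := by
        intro o ho z hz i hi hb
        by_cases hz1 : z = 2
        · subst hz1
          simp only [if_true] at hb
          have hm := tabL2_complete (o 0).val (val_lt4 _) (o 1).val (val_lt4 _) (o 2).val (val_lt4 _) (o 3).val
            (val_lt4 _) ho i hi hb
          simpa [ent, pm] using hm
        · simp [hz1] at hb
      local_ := by
        intro o ho z hz i hi hb
        by_cases hz1 : z = 2
        · exact Or.inl hz1.symm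
        · simp [hz1] at hb
      three := by
        intro o ho z hz
        by_cases hz1 : z = 2
        · simp only [hz1, if_true]
          exact pm_three o 2 (by norm_num)
        · simp [hz1, hits16_zero]
      cls_lt := fun _ _ => by norm_num }
  refine srch_sound hT false 14 65535 65535 (pm τ 2) 65535 0 0 5 0 (by norm_num) hcert
    ((A.filter fun o => (o 2).val = 2 ∨ (o 2).val = 3).erase τ) ⟨?_, ?_, ?_⟩
  · intro o ho
    exact (Finset.mem_filter.1 (Finset.mem_of_mem_erase ho)).2
  · intro w hw
    dsimp only
    have hmem : τ ∈ (A.filter fun o => (o 2).val = 2 ∨ (o 2).val = 3) := Finset.mem_filter.2 ⟨hτ, hlv⟩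
    have hc := Finset.card_erase_of_mem hmem
    have hle := card_filter_or_le A (fun o : PT => (o 2).val = 2) (fun o : PT => (o 2).val = 3)
    have hc' : ((A.filter fun o => (o 2).val = 2 ∨ (o 2).val = 3).erase τ).card ≤ 5 := by
      rw [hc]; unfold cntN at h23; omega
    interval_cases w
    · simp [sel]
    · simp [sel]
    · simpa [sel] using hc'
    · simp [sel]
  · intro z hz i hi hci
    dsimp only at hci
    interval_cases z
    · exact absurd (testBit_full16 i hi) (by simpa [sel] using hci)
    · exact absurd (testBit_full16 i hi) (by simpa [sel] using hci)
    · simp only [sel] at hci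
      obtain ⟨a, ha, hab⟩ := exists_hit A hA 2 (by norm_num) i hi
      have hlv' : (a 2).val = 2 ∨ (a 2).val = 3 := by simpa using pm_local a 2 (by norm_num) i hi hab
      have hne' : a ≠ τ := by
        rintro rfl
        rw [hci] at hab
        exact Bool.false_ne_true hab
      exact ⟨a, Finset.mem_erase.2 ⟨hne', Finset.mem_filter.2 ⟨ha, hlv'⟩⟩, by simpa using hab⟩
    · exact absurd (testBit_full16 i hi) (by simpa [sel] using hci)

/-- under tightness every point of the transversal is admissible for the main search. -/
theorem allowed_of_tight (A : Finset PT) (hA : HitsAll A 0) (h12 : cntN A 1 + cntN A 2 ≤ 6)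
    (h23 : cntN A 2 + cntN A 3 ≤ 6) : ∀ τ ∈ A, allowedP τ := by
  intro τ hτ
  have hl := val_lt4 (τ 2)
  have T1 := tight_one A hA h12 τ hτ
  have T2 := tight_two A hA h23 τ hτ
  unfold allowedP
  rcases (by omega : (τ 2).val = 0 ∨ (τ 2).val = 1 ∨ (τ 2).val = 2 ∨ (τ 2).val = 3) with h | h | h | h
  · exact Or.inl h
  · exact allowed_one _ (val_lt4 _) _ (val_lt4 _) _ (val_lt4 _) _ (val_lt4 _) h (T1 (Or.inl h))
  · exact (allowed_two _ (val_lt4 _) _ (val_lt4 _) _ (val_lt4 _) _ (val_lt4 _) h (T1 (Or.inr h)) (T2 (Or.inl h))).1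
  · exact allowed_three _ (val_lt4 _) _ (val_lt4 _) _ (val_lt4 _) _ (val_lt4 _) h (T2 (Or.inr h))

/-- the level-`2` points under tightness: residue `2`, and either `p₀` or coded in `lv2rest`. -/
theorem level_two_of_tight (A : Finset PT) (hA : HitsAll A 0) (h12 : cntN A 1 + cntN A 2 ≤ 6)
    (h23 : cntN A 2 + cntN A 3 ≤ 6) (τ : PT) (hτ : τ ∈ A) (h2 : (τ 2).val = 2) :
    ((τ 0).val + (τ 1).val + (τ 2).val + (τ 3).val) % 4 = 2 ∧
      (τ = p0 ∨ ((τ 0).val, (τ 1).val, (τ 2).val, (τ 3).val) ∈ lv2rest) := by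
  have T1 := tight_one A hA h12 τ hτ (Or.inr h2)
  have T2 := tight_two A hA h23 τ hτ (Or.inl h2)
  obtain ⟨_, hres, hmem⟩ := allowed_two _ (val_lt4 _) _ (val_lt4 _) _ (val_lt4 _) _ (val_lt4 _) h2 T1 T2
  refine ⟨hres, ?_⟩
  rcases hmem with h | h
  · left
    rw [← mkPT_val τ, h.1, h.2.1, h2, h.2.2]
    rfl
  · exact Or.inr h

/-! ## §5 the main frame (kernel certificates `certMain_*`) -/

/-- the main table is complete, local and light over admissible points. -/
theorem tabOK_main : TabOK (fun τ : PT => (τ 2).val) pm allowedP tabMain :=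
  { complete := fun o ho z hz i hi hb =>
      tabMain_complete _ (val_lt4 _) _ (val_lt4 _) _ (val_lt4 _) _ (val_lt4 _) ho z hz i hi hb
    local_ := fun o _ z hz i hi hb => pm_local o z hz i hi hb
    three := fun o _ z hz => pm_three o z hz
    cls_lt := fun o _ => val_lt4 _ }

/-- the case `a = 6` (no level-`2` point): budgets `(1, 6, 0, 6)`, certificate `certMain_six`. -/
theorem frame_six (A : Finset PT) (hA : HitsAll A 0) (hall : ∀ τ ∈ A, allowedP τ) (h0 : cntN A 0 ≤ 1)
    (h1 : cntN A 1 ≤ 6) (h2 : cntN A 2 = 0) (h3 : cntN A 3 ≤ 6) : False := by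
  classical
  refine srch_sound tabOK_main false 14 0 0 0 0 1 6 0 6 (by norm_num) certMain_six A ⟨hall, ?_, ?_⟩
  · intro w hw
    dsimp only
    unfold cntN at h0 h1 h2 h3
    interval_cases w
    · simpa [sel] using h0
    · simpa [sel] using h1
    · simp [sel, h2]
    · simpa [sel] using h3
  · intro z hz i hi _
    exact exists_hit A hA z hz i hi

theorem pm_p0 (z : ℕ) : pm p0 z = maskTab 0 0 2 0 z := by
  have h0 : (p0 0).val = 0 := by decide +kernel
  have h1 : (p0 1).val = 0 := by decide +kernel
  have h2 : (p0 2).val = 2 := by decide +kernel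
  have h3 : (p0 3).val = 0 := by decide +kernel
  simp only [pm, h0, h1, h2, h3]

/-- the code of a torus point. -/
def cd (τ : PT) : Code := ((τ 0).val, (τ 1).val, (τ 2).val, (τ 3).val)

theorem cd_injective : Function.Injective cd := by
  intro τ τ' h
  simp only [cd, Prod.mk.injEq] at h
  rw [← mkPT_val τ, ← mkPT_val τ', h.1, h.2.1, h.2.2.1, h.2.2.2]

/-- the codes of the level-`2` points other than `p₀`. -/
def codes (A : Finset PT) : Finset Code := ((A.filter fun τ => (τ 2).val = 2).erase p0).image cd

/-- the PLACEMENT of `A`: its level-`2` codes other than `p₀`, listed in the order of `lv2rest`. -/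
def place (A : Finset PT) : List Code := lv2rest.filter fun t => decide (t ∈ codes A)

theorem codes_sub (A : Finset PT) (hA : HitsAll A 0) (h12 : cntN A 1 + cntN A 2 ≤ 6) (h23 : cntN A 2 + cntN A 3 ≤ 6) :
    ∀ u ∈ codes A, u ∈ lv2rest := by
  intro u hu
  obtain ⟨τ, hτ, rfl⟩ := Finset.mem_image.1 hu
  obtain ⟨hne, hτA⟩ := Finset.mem_erase.1 hτ
  obtain ⟨hA', hl2⟩ := Finset.mem_filter.1 hτA
  rcases (level_two_of_tight A hA h12 h23 τ hA' hl2).2 with h | h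
  · exact absurd h hne
  · exact h

theorem mem_place {A : Finset PT} (hsub : ∀ u ∈ codes A, u ∈ lv2rest) {t : Code} : t ∈ place A ↔ t ∈ codes A := by
  unfold place
  rw [List.mem_filter, decide_eq_true_eq]
  exact ⟨fun h => h.2, fun h => ⟨hsub t h, h⟩⟩

/-- the placement is a `(5−a)`-sublist of `lv2rest`. -/
theorem place_mem_sublistsLen (A : Finset PT) (hsub : ∀ u ∈ codes A, u ∈ lv2rest) (a : ℕ) (ha : a ≤ 5)
    (h2 : cntN A 2 = 6 - a) (hp0 : p0 ∈ A) : place A ∈ lv2rest.sublistsLen (5 - a) := by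
  classical
  refine List.mem_sublistsLen.2 ⟨List.filter_sublist, ?_⟩
  have hnd : (place A).Nodup := lv2rest_nodup.filter _
  rw [← List.toFinset_card_of_nodup hnd]
  unfold place
  rw [List.toFinset_filter]
  have e : lv2rest.toFinset.filter (fun t => decide (t ∈ codes A) = true) = codes A := by
    ext t
    simp only [Finset.mem_filter, List.mem_toFinset, decide_eq_true_eq]
    exact ⟨fun h => h.2, fun h => ⟨hsub t h, h⟩⟩
  have hp : p0 ∈ (A.filter fun τ => (τ 2).val = 2) := Finset.mem_filter.2 ⟨hp0, by decide +kernel⟩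
  rw [e, codes, Finset.card_image_of_injective _ cd_injective, Finset.card_erase_of_mem hp]
  unfold cntN at h2
  omega

/-- **the main frame** (`a ≤ 5`, `p₀ ∈ A`, placement certified): the certificate `certMainL ob a R` covers the placement of `A`, says the
first-unhit-box search for the levels `0, 1, 3` with budgets `(7−a, a, 0, a)` fails, and `srch_sound` turns this into a contradiction. -/
theorem frame_main (a : ℕ) (ha : a ≤ 5) (ob : Bool) (R : List (List Code)) (hcert : certMainL ob a R = true) (A : Finset PT)
    (hA : HitsAll A 0) (h12 : cntN A 1 + cntN A 2 ≤ 6) (h23 : cntN A 2 + cntN A 3 ≤ 6)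
    (h0 : cntN A 0 ≤ 7 - a) (h1 : cntN A 1 ≤ a) (h3 : cntN A 3 ≤ a) (hl : place A ∈ R) : False := by
  classical
  have hall := allowed_of_tight A hA h12 h23
  have hsub := codes_sub A hA h12 h23
  have hs := List.all_eq_true.1 hcert (place A) hl
  have hs' : srch tabMain ob 14 (umask 0 (place A)) (umask 1 (place A)) (umask 2 (place A)) (umask 3 (place A))
      (7 - a) a 0 a = false := by
    simpa using hs
  refine srch_sound tabOK_main ob 14 _ _ _ _ (7 - a) a 0 a (by omega) hs' (A.filter fun τ => (τ 2).val ≠ 2)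
    ⟨?_, ?_, ?_⟩
  · intro o ho
    exact hall o (Finset.mem_filter.1 ho).1
  · intro w hw
    dsimp only
    have sub : ∀ w', ((A.filter fun τ => (τ 2).val ≠ 2).filter fun o => (o 2).val = w').card ≤ cntN A w' :=
      fun w' => Finset.card_le_card (Finset.filter_subset_filter _ (Finset.filter_subset _ _))
    interval_cases w
    · exact (sub 0).trans (by simpa [sel] using h0)
    · exact (sub 1).trans (by simpa [sel] using h1)
    · rw [show sel 2 (7 - a) a 0 a = 0 from rfl, Nat.le_zero, Finset.card_eq_zero, Finset.filter_eq_empty_iff]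
      intro o ho
      exact (Finset.mem_filter.1 ho).2
    · exact (sub 3).trans (by simpa [sel] using h3)
  · intro z hz i hi hci
    dsimp only at hci
    have hsel : sel z (umask 0 (place A)) (umask 1 (place A)) (umask 2 (place A)) (umask 3 (place A)) = umask z (place A) := by
      interval_cases z <;> rfl
    rw [hsel] at hci
    obtain ⟨o, hoA, hob⟩ := exists_hit A hA z hz i hi
    by_cases hl2 : (o 2).val = 2
    · exfalso
      by_cases hop : o = p0
      · subst hop
        rw [pm_p0] at hob
        have hh := testBit_umask_head z i (place A) hob
        rw [hci] at hh
        exact Bool.false_ne_true hh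
      · have hoc : cd o ∈ codes A :=
          Finset.mem_image_of_mem cd (Finset.mem_erase.2 ⟨hop, Finset.mem_filter.2 ⟨hoA, hl2⟩⟩)
        have hol : cd o ∈ place A := (mem_place hsub).2 hoc
        have hh := testBit_umask_mem z i (place A) (cd o) hol hob
        rw [hci] at hh
        exact Bool.false_ne_true hh
    · exact ⟨o, Finset.mem_filter.2 ⟨hoA, hl2⟩, hob⟩

/-! ## §6 the symmetry `S₃` of the coordinates `0, 1, 3`, second normalisation, and the covering theorem -/

/-- the six permutations of the coordinates `0, 1, 3` (fixing `2`), matching `Cover.pcode`. -/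
def piF : ℕ → Fin 4 → Fin 4
  | 1 => ![1, 0, 2, 3]
  | 2 => ![3, 1, 2, 0]
  | 3 => ![0, 3, 2, 1]
  | 4 => ![3, 0, 2, 1]
  | 5 => ![1, 3, 2, 0]
  | _ => ![0, 1, 2, 3]

/-- their inverses. -/
def piI : ℕ → Fin 4 → Fin 4
  | 1 => ![1, 0, 2, 3]
  | 2 => ![3, 1, 2, 0]
  | 3 => ![0, 3, 2, 1]
  | 4 => ![1, 3, 2, 0]
  | 5 => ![3, 0, 2, 1]
  | _ => ![0, 1, 2, 3]

theorem piF_piI : ∀ p < 6, ∀ f : Fin 4, piF p (piI p f) = f := by decide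
theorem piI_piF : ∀ p < 6, ∀ f : Fin 4, piI p (piF p f) = f := by decide
theorem piF_two : ∀ p < 6, piF p 2 = 2 := by decide

/-- the coordinate permutation acting on the torus. -/
def permPT (p : ℕ) (τ : PT) : PT := fun f => τ (piF p f)

theorem permPT_injective (p : ℕ) (hp : p < 6) : Function.Injective (permPT p) := by
  intro τ τ' h
  funext f
  have := congrFun h (piI p f)
  simpa [permPT, piF_piI p hp] using this

theorem permPT_p0 : ∀ p < 6, permPT p p0 = p0 := by decide +kernel

theorem sum_piI (p : ℕ) (hp : p < 6) (s : PT) : ∑ f, s (piI p f) = ∑ f, s f := by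
  interval_cases p <;> simp only [piI, Fin.sum_univ_four, Matrix.cons_val_zero, Matrix.cons_val_one, Matrix.head_cons,
    Matrix.cons_val_two, Matrix.tail_cons, Matrix.cons_val_three] <;> ring

theorem cd_permPT (p : ℕ) (hp : p < 6) (τ : PT) : cd (permPT p τ) = pcode p (cd τ) := by
  interval_cases p <;> rfl

/-- a coordinate permutation carries a transversal of class `0` to a transversal of class `0`. -/
theorem hitsAll_perm (p : ℕ) (hp : p < 6) (A : Finset PT) (h : HitsAll A 0) : HitsAll (A.image (permPT p)) 0 := by
  intro s hs
  have hs' : (fun f => s (piI p f)) ∈ cornerClass 0 := by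
    rw [mem_cornerClass_iff] at hs ⊢
    rw [sum_piI p hp s, hs]
  obtain ⟨a, ha, hab⟩ := h _ hs'
  refine ⟨permPT p a, Finset.mem_image_of_mem _ ha, ?_⟩
  rw [mem_pbox] at hab ⊢
  intro f
  have := hab (piF p f)
  simpa only [permPT, piI_piF p hp f] using this

theorem cntN_perm (p : ℕ) (hp : p < 6) (A : Finset PT) (w : ℕ) : cntN (A.image (permPT p)) w = cntN A w := by
  classical
  unfold cntN
  rw [Finset.filter_image]
  have e : (A.filter fun τ => (permPT p τ 2).val = w) = A.filter fun τ => (τ 2).val = w := by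
    congr 1
    funext τ
    simp only [permPT, piF_two p hp]
  rw [e, Finset.card_image_of_injective _ (permPT_injective p hp)]

theorem codes_perm (p : ℕ) (hp : p < 6) (A : Finset PT) : codes (A.image (permPT p)) = (codes A).image (pcode p) := by
  classical
  unfold codes
  rw [Finset.filter_image]
  have e : (A.filter fun τ => (permPT p τ 2).val = 2) = A.filter fun τ => (τ 2).val = 2 := by
    congr 1
    funext τ
    simp only [permPT, piF_two p hp]
  rw [e]
  conv_lhs => rw [← permPT_p0 p hp]
  rw [← Finset.image_erase (permPT_injective p hp), Finset.image_image, Finset.image_image]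
  congr 1
  funext τ
  exact cd_permPT p hp τ

theorem place_perm (p : ℕ) (hp : p < 6) (A : Finset PT) (hsub : ∀ u ∈ codes A, u ∈ lv2rest) :
    place (A.image (permPT p)) = lv2rest.filter fun t => decide (t ∈ (place A).map (pcode p)) := by
  classical
  unfold place
  apply List.filter_congr
  intro t _
  rw [codes_perm p hp]
  simp only [Finset.mem_image, List.mem_map, decide_eq_decide]
  constructor
  · rintro ⟨u, hu, rfl⟩
    exact ⟨u, (mem_place hsub).2 hu, rfl⟩
  · rintro ⟨u, hu, rfl⟩
    exact ⟨u, (mem_place hsub).1 hu, rfl⟩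

theorem sum_p0 : ∑ f, p0 f = 2 := by decide +kernel

theorem p0_two : p0 2 = 2 := by decide +kernel

/-- **second normalisation**: a level-`2` point (residue `2`) is moved to `p₀` by a translation of sum `0` fixing levels. -/
theorem normalise_two (A : Finset PT) (hA : HitsAll A 0) (h12 : cntN A 1 + cntN A 2 ≤ 6) (h23 : cntN A 2 + cntN A 3 ≤ 6)
    (hne : cntN A 2 ≠ 0) :
    ∃ B : Finset PT, HitsAll B 0 ∧ B.card = A.card ∧ (∀ w, w < 4 → cntN B w = cntN A w) ∧ p0 ∈ B := by
  classical
  obtain ⟨τ, hτ⟩ := Finset.card_pos.1 (Nat.pos_of_ne_zero hne)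
  obtain ⟨hτA, hτ2⟩ := Finset.mem_filter.1 hτ
  obtain ⟨hres, _⟩ := level_two_of_tight A hA h12 h23 τ hτA hτ2
  have hsumτ : ∑ f, τ f = 2 := by
    rw [Fin.sum_univ_four, ← ZMod.natCast_zmod_val (τ 0), ← ZMod.natCast_zmod_val (τ 1),
      ← ZMod.natCast_zmod_val (τ 2), ← ZMod.natCast_zmod_val (τ 3)]
    push_cast
    rw [show ((τ 0).val : ZMod 4) + (τ 1).val + (τ 2).val + (τ 3).val =
      (((τ 0).val + (τ 1).val + (τ 2).val + (τ 3).val : ℕ) : ZMod 4) by push_cast; ring]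
    rw [← ZMod.natCast_mod, hres]
    rfl
  let v : PT := p0 - τ
  have hv : (0 : ZMod 4) + ∑ f, v f = 0 := by
    simp only [v, Pi.sub_apply, Finset.sum_sub_distrib, sum_p0, hsumτ]
    ring
  have hv2 : (v 2).val = 0 := by
    have hτ2' : τ 2 = 2 := by
      rw [← ZMod.natCast_zmod_val (τ 2), hτ2]; rfl
    simp only [v, Pi.sub_apply, p0_two, hτ2', sub_self, ZMod.val_zero]
  refine ⟨A.image (· + v), by simpa [hv] using hitsAll_translate A 0 v hA, card_translate _ _, ?_, ?_⟩
  · intro w hw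
    have := cntN_translate A v w hw
    rw [hv2, add_zero, Nat.mod_eq_of_lt hw] at this
    exact this
  · exact Finset.mem_image.2 ⟨τ, hτA, by simp [v]⟩

/-- **THE COVERING THEOREM, class 0**: no `13` points of the phase torus meet all `64` boxes of class `0`. -/
theorem cover13_zero (A : Finset PT) (hA : HitsAll A 0) (hcard : A.card ≤ 13) : False := by
  classical
  obtain ⟨B, hB, hBc, h12, h23⟩ := normalise_one A hA hcard
  have hsB := card_eq_sum_cntN B
  by_cases hc2 : cntN B 2 = 0
  · exact frame_six B hB (allowed_of_tight B hB h12.le h23.le) (by omega) (by omega) hc2 (by omega)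
  obtain ⟨C, hC, hCc, hcnt, hp0⟩ := normalise_two B hB h12.le h23.le hc2
  have c0 := hcnt 0 (by norm_num)
  have c1 := hcnt 1 (by norm_num)
  have c2 := hcnt 2 (by norm_num)
  have c3 := hcnt 3 (by norm_num)
  have hsC := card_eq_sum_cntN C
  -- `a := cntN C 1`; counts `(≤ 7−a, a, 6−a, ≤ a)`
  have ha : cntN C 1 ≤ 5 := by omega
  obtain ⟨ob, hcert⟩ := certR_of_le (cntN C 1) ha
  have hsub := codes_sub C hC (by omega) (by omega)
  have hlen := place_mem_sublistsLen C hsub (cntN C 1) ha (by omega) hp0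
  by_cases h234 : cntN C 1 = 2 ∨ cntN C 1 = 3 ∨ cntN C 1 = 4
  · -- symmetry path: carry the placement to a representative
    obtain ⟨p, hp, hrep⟩ := cover_spec (cntN C 1) h234 (place C) hlen
    have d0 := cntN_perm p hp C 0
    have d1 := cntN_perm p hp C 1
    have d2 := cntN_perm p hp C 2
    have d3 := cntN_perm p hp C 3
    refine frame_main (cntN C 1) ha ob (R (cntN C 1)) hcert (C.image (permPT p)) (hitsAll_perm p hp C hC)
      (by omega) (by omega) (by omega) (by omega) (by omega) ?_
    rw [place_perm p hp C hsub]
    exact hrep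
  · -- direct path: `R a` is the full list of sublists
    refine frame_main (cntN C 1) ha ob (R (cntN C 1)) hcert C hC (by omega) (by omega) (by omega) le_rfl (by omega) ?_
    have hR : R (cntN C 1) = lv2rest.sublistsLen (5 - cntN C 1) := by
      rcases (by omega : cntN C 1 = 0 ∨ cntN C 1 = 1 ∨ cntN C 1 = 5) with h | h | h <;> rw [h] <;> rfl
    rw [hR]
    exact hlen

/-- **THE COVERING THEOREM** `t(𝓑_j) ≥ 14`: no `13` points of `(ℤ/4)⁴` meet every box of a class. -/
theorem cover13 (j : ZMod 4) (A : Finset PT) (hcard : A.card ≤ 13) (h : ∀ s ∈ cornerClass j, ∃ a ∈ A, a ∈ pbox s) :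
    False := by
  classical
  let v : PT := ![-j, 0, 0, 0]
  have hv : j + ∑ f, v f = 0 := by
    rw [Fin.sum_univ_four]
    simp [v]
  have h' := hitsAll_translate A j v h
  rw [hv] at h'
  exact cover13_zero _ h' (by rw [card_translate]; exact hcard)

/-! ## §7 the phase-torus law at corank ≤ 13 and the exact threshold -/

/-- **The phase-torus law at corank ≤ 13** (box law ⇒ a transversal of a box class ⇒ `|A| ≥ 14` by `cover13`). -/
theorem phaseTorusLawN_thirteen : PhaseTorusLawN 13 := by
  classical
  intro ω A hA hω hK
  by_contra hμ
  have hcls : ∀ (j : ZMod 4) (s : PT), s ∈ cornerClass j →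
      32 * boxSum ω s = -(e (-j) * moment ω (fun _ => 1)).re := by
    intro j s hs
    rw [boxLaw ω hK s, sum_of_mem_cornerClass hs]
  obtain ⟨j, hj⟩ : ∃ j : ZMod 4, ∀ s ∈ cornerClass j, 0 < boxSum ω s := by
    have hre_or : (moment ω (fun _ => 1)).re ≠ 0 ∨ (moment ω (fun _ => 1)).im ≠ 0 := by
      by_contra h
      push_neg at h
      exact hμ (Complex.ext (by simpa using h.1) (by simpa using h.2))
    rcases hre_or with h | h
    · rcases lt_or_gt_of_ne h with hneg | hpos
      · refine ⟨0, fun s hs => ?_⟩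
        have := hcls 0 s hs
        rw [neg_zero, e_zero, one_mul] at this
        linarith
      · refine ⟨2, fun s hs => ?_⟩
        have := hcls 2 s hs
        rw [show (-2 : ZMod 4) = 2 from by decide, e_two] at this
        simp at this
        linarith
    · rcases lt_or_gt_of_ne h with hneg | hpos
      · refine ⟨1, fun s hs => ?_⟩
        have := hcls 1 s hs
        rw [e_neg_one] at this
        simp at this
        linarith
      · refine ⟨3, fun s hs => ?_⟩
        have := hcls 3 s hs
        rw [show (-3 : ZMod 4) = 1 from by decide, e_one] at this
        simp at this
        linarith
  exact cover13 j A hA (fun s hs => exists_mem_of_boxSum_pos ω A hω s (hj s hs))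

/-- **THE EXACT CORANK THRESHOLD of the phase-torus law is `13 ∕ 14`** (with `not_phaseTorusLawN_fourteen`). -/
theorem phaseTorus_threshold : PhaseTorusLawN 13 ∧ ¬ PhaseTorusLawN 14 :=
  ⟨phaseTorusLawN_thirteen, not_phaseTorusLawN_fourteen⟩

/-- … equivalently: `PhaseTorusLawN γ ↔ γ ≤ 13`. -/
theorem phaseTorusLawN_iff (γ : ℕ) : PhaseTorusLawN γ ↔ γ ≤ 13 :=
  ⟨fun h => by
    by_contra hlt
    exact not_phaseTorusLawN_of_fourteen_le (by omega) h,
   fun h => phaseTorusLawN_mono h phaseTorusLawN_thirteen⟩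

end Summit.HodgeConjecture.HodgeConjecture.Cruxes.BlochSeedDiscOne.PhaseTorus
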